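import Summits.BirchSwinnertonDyer.Rank1Residual.GaloisImage.KolyvaginSystemOfEulerSystemExists
import Summits.BirchSwinnertonDyer.Rank1Residual.GaloisImage.PropagatedStructureUnramified
import Summits.BirchSwinnertonDyer.Rank1Residual.GaloisImage.LocalH1VanishingOfNoTorsion
import Summits.BirchSwinnertonDyer.Rank1Residual.GaloisImage.SakamotoN11Instance
import HarnessLib

/-!
# THEOREM D for Mazur–Rubin's canonical structure `𝓕_can` on `E[p^{k+1}]`: an Euler system of
# `T_p E / ℚ` yields a Kolyvagin system in `KS(E[p^k·p], 𝓕_can, 𝒫)` on the rows with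
# `E(ℚ_w)[p] = 0` at every bad `w ≠ p` and `𝓕_can = ⊤` at `p`
# (cell `b2b-bsdres`, n1011 p11 GEN 10; row T-DER, THEOREM D file D4 = D5a read for
# `𝓕 = propagatedSelmerStructure W p k`)

HONEST FRAMING (cell `b2b-bsdres`, run/shared/lean/b2b/bsd-rank1-residual/, verbatim in every
file): the goal of the cell is to DELETE the COMBINATION-SHAPED residual classes of the
Birch–Swinnerton-Dyer formula for ALL analytic-rank `≤ 1` elliptic curves over `ℚ` — "full BSD
formula for every rank `≤ 1` curve in class `C`" assembled STRICTLY from published theorems — so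
that the rank-`≤ 1` remainder becomes exactly the CONSTRUCTION-SHAPED classes, which are TYPED
(missing-input `Prop`s), NOT attempted. This is not "finishing BSD". Team n1011: research route on
the CONSTRUCTION-SHAPED class X4 / §I N11 (route-1 PORT, (P-DER), clause C1/C0); TOOL theorem.
HONEST LIMITS: NO Euler system is asserted to exist (hypothesis `hc`; the PORT binds Kato's by the
§48.4 socket); clause C1 is met with `κ′ = κ`; the value clauses C2/C3 are NOT here; the two
row-class certificates are DISPLAYED: `hbad` (`E(ℚ_w)[p] = 0` at every bad `w ≠ p` — the cell's
"hloc" certificate, F10) and `htop : 𝓕_can,p = ⊤` at the place `p` (at `p = 3`, `E(ℚ₃)[3] = 0`: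
F11/F12 `propagatedSelmerStructure_three_eq_top_of_torsion_eq_zero` discharge it — the D7 / `t = 0`
rows).  No definition, no named fact, no `sorry`.

## What

**`exists_isKolyvaginSystem_propagatedSelmerStructure`** = D5a
`exists_isKolyvaginSystem_of_eulerSystem` for the spelling `m = p^k · p` of the PORT
(`W.torsionGaloisModule (↑p^k * ↑p)`; the `ℤ/p^{k+1}`-structure is n1011-p13's
`SakamotoN11Instance.instModule*ZModGeomTorsionPowMul`) and `𝓕 = propagatedSelmerStructure W p k`
(Mazur–Rubin's `𝓕_can` propagated from `T_pE`, tree `PropagatedStructure`):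
`hunr` is `propagatedSelmerStructure_inr_eq_unramifiedSubgroup` (`𝓕_can,w = H¹_ur` at good
`w ≠ p`), and the vacuity at the bad `w ≠ p` is F10
`subsingleton_galoisCohomology_one_torsion_of_torsion_eq_zero` (`H¹(ℚ_w, E[p^{k+1}]) = 0` when
`E(ℚ_w)[p] = 0`, Tate's local Euler characteristic).  Conclusion: generators `σ`, transports `Φ_r`,
ONE family `κ` with `D.IsKolyvaginSystem (propagatedSelmerStructure W p k) κ` and the derivative
characterisation at every level.
References: B. Mazur, K. Rubin, Mem. AMS 799 (2004), Def. 3.2.1, Thm. 3.2.4, App. A; K. Rubin,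
PCMI 18 (2011), §3.1; J. Milne, *ADT*, I Thm. 2.8.
-/

noncomputable section

open CategoryTheory Function Finset Polynomial Field IsDedekindDomain
open scoped NumberField Classical
open Literature.NumberTheory.GaloisRepresentations Literature.NumberTheory.EllipticCurves
open Literature.NumberTheory.GaloisRepresentations.DiscreteGaloisModule
open Literature.NumberTheory.GaloisCohomology
open Summit.BirchSwinnertonDyer.Rank1Residual.GaloisImage.CoeffTransport
open Summit.BirchSwinnertonDyer.Rank1Residual.GaloisImage.CyclotomicLevel
open Rat.HeightOneSpectrum

universe u

namespace Summit.BirchSwinnertonDyer.Rank1Residual.GaloisImage.Derivative.Rat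

variable (W : WeierstrassCurve ℚ) [W.IsElliptic] [W.IsGloballyMinimal] (p : ℕ) [Fact p.Prime]
variable [Module.Free ℤ_[p] (W.tateModule p)] [Module.Finite ℤ_[p] (W.tateModule p)]
  [ContinuousSMul ℤ_[p] (W.tateModule p)]

/-- Local notation: `T∞ = T_p E` as a continuous `G_ℚ`-representation. -/
local notation3 "T∞" => WeierstrassCurve.tateGaloisRep W p (W.continuous_galoisRepTate_holds p)

/-- Local notation: `𝐫⟦f, T′, U⟧ = f_* : H¹(U, T_pE) → H¹(U, T′)`. -/
local notation3 (prettyPrint := false) "𝐫⟦" f ", " Tg ", " U "⟧" =>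
  ContinuousCohomology.map (ContinuousMonoidHom.id _)
    (X := subgroupRep (ContinuousRep.toTopRep T∞) U)
    (Y := subgroupRep (ContinuousRep.toTopRep Tg) U)
    ((TopRep.resFunctor (Subgroup.subtype U)).map f) 1

variable (S : Set (HeightOneSpectrum (𝓞 ℚ)))

/-- Local notation: `𝓛` = the cyclotomic Euler-system levels `ℚ(μ_{p^{n+1}}, μ_r)`, `r ∩ S = ∅`. -/
local notation3 "𝓛" => cyclotomicLevelsRat p S

/-- Local notation: `𝐃⟦A, X, U, τ⟧ ℓ = ∑_{j < ℓ−1} j·(τ_ℓ)_*^j`, Kolyvagin's derivative operator of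
the place `ℓ` on `H¹(U, X)` (`A`-linear) for the generator `τ_ℓ`. -/
local notation3 (prettyPrint := false) "𝐃⟦" A ", " X ", " U ", " τ "⟧" =>
  fun ℓ : HeightOneSpectrum (𝓞 ℚ) =>
  ∑ j ∈ Finset.range (((primesEquiv ℓ : Nat.Primes) : ℕ) - 1),
    (j : Module.End A (continuousCohomology 1 (subgroupRep X U))) *
      (conjMap X U ((τ : HeightOneSpectrum (𝓞 ℚ) → absoluteGaloisGroup ℚ) ℓ) 1).hom.toLinearMap ^ j

omit [W.IsGloballyMinimal] [Module.Free ℤ_[p] (W.tateModule p)] [Module.Finite ℤ_[p] (W.tateModule p)]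
  [ContinuousSMul ℤ_[p] (W.tateModule p)] in
/-- **`𝓕_can,w = ⊤` (indeed `H¹(ℚ_w, E[p^k·p]) = 0`) at a place `w ∤ p` with `E(ℚ_w)[p] = 0`** —
F10 `subsingleton_galoisCohomology_one_torsion_of_torsion_eq_zero` read in the spelling `p^k · p`.
[cite: MilneADT2006, Ch. I §2, Thm. 2.8 (p. 31)] -/
theorem propagatedSelmerStructure_inr_eq_top_of_torsion_eq_zero (k : ℕ) {w : HeightOneSpectrum (𝓞 ℚ)}
    (hpw : ((p : ℕ) : 𝓞 ℚ) ∉ w.asIdeal)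
    (htors : ∀ P : (W.baseChange (w.adicCompletion ℚ)).toAffine.Point, p • P = 0 → P = 0) :
    propagatedSelmerStructure W p k (Sum.inr w) = ⊤ := by
  have hsub := subsingleton_galoisCohomology_one_torsion_of_torsion_eq_zero W w p hpw htors k
  have hsp : ((p ^ (k + 1) : ℕ) : ℤ) = (p : ℤ) ^ k * (p : ℤ) := by push_cast; ring
  rw [hsp] at hsub
  refine eq_top_iff.2 fun x _ => ?_
  rw [@Subsingleton.elim _ hsub x 0]
  exact zero_mem _

/-- **THEOREM D for `𝓕_can = propagatedSelmerStructure W p k`** (rows with `E(ℚ_w)[p] = 0` at every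
bad `w ≠ p` and `𝓕_can,p = ⊤`): see the module docstring; every binder of D5a
`exists_isKolyvaginSystem_of_eulerSystem` in the spelling `m = p^k · p`, `n = k + 1`, plus the two
row-class certificates `hbad`, `htop`.
[cite: MazurRubin2004, Def. 3.2.1, Thm. 3.2.4 and App. A] [cite: Rubin2011, §3.1 (p. 29)]
[cite: Sakamoto2024, Def. 4.1 (p. 926)] -/
theorem exists_isKolyvaginSystem_propagatedSelmerStructure (hp2 : p ≠ 2)
    {c : ∀ (i : ℕ) (r : (𝓛).Ideals), H1 T∞ ((𝓛).level i r.1)}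
    (hc : IsEulerSystem 𝓛 T∞ p c)
    {M' : Type} [AddCommGroup M'] [Module ℤ_[p] M'] [TopologicalSpace M'] [DiscreteTopology M']
    [IsTopologicalAddGroup M'] [ContinuousSMul ℤ_[p] M'] {T' : GaloisRep ℚ ℤ_[p] M'}
    (red : T∞.toTopRep ⟶ T'.toTopRep) (hred : Function.Surjective red.hom)
    {k : ℕ} (hM : ∀ m : M', ((p : ℤ_[p]) ^ (k + 1)) • m = 0)
    (e : M' →+ WeierstrassCurve.geomTorsion W ((p : ℤ) ^ k * (p : ℤ))) (hec : Continuous e)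
    (he : ∀ (g : absoluteGaloisGroup ℚ) (x : M'),
      e (T'.toTopRep.ρ g x) = (W.torsionGaloisModule ((p : ℤ) ^ k * (p : ℤ))).toTopRep.ρ g (e x))
    (einv : WeierstrassCurve.geomTorsion W ((p : ℤ) ^ k * (p : ℤ)) →+ M') (hic : Continuous einv)
    (h₁ : ∀ x, einv (e x) = x) (h₂ : ∀ y, e (einv y) = y)
    (hirr : W.HasIrreducibleModPGaloisRep p)
    (D : KolyvaginDatum (W.torsionGaloisModule ((p : ℤ) ^ k * (p : ℤ))))
    (hT : D.transverse = cyclotomicTransverse (W.torsionGaloisModule ((p : ℤ) ^ k * (p : ℤ))))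
    {η : (ℓ : HeightOneSpectrum (𝓞 ℚ)) → (ZMod (Ideal.absNorm ℓ.asIdeal))ˣ}
    (hD : D.HasCanonicalComparison (p ^ (k + 1)) η)
    (hPr : D.primes ⊆ (𝓛).primes)
    (hKol : ∀ ℓ ∈ D.primes, Kato.IsKolyvaginPrime W p (k + 1) ((primesEquiv ℓ : Nat.Primes) : ℕ))
    (hbad : ∀ w : HeightOneSpectrum (𝓞 ℚ), ¬ W.HasGoodReductionAt w →
      ((primesEquiv w : Nat.Primes) : ℕ) ≠ p →
        ∀ P : (W.baseChange (w.adicCompletion ℚ)).toAffine.Point, p • P = 0 → P = 0)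
    (htop : ∀ w : HeightOneSpectrum (𝓞 ℚ), ((primesEquiv w : Nat.Primes) : ℕ) = p →
      propagatedSelmerStructure W p k (Sum.inr w) = ⊤) :
    ∃ (σ : HeightOneSpectrum (𝓞 ℚ) → absoluteGaloisGroup ℚ)
      (Φ : ∀ r : Finset (HeightOneSpectrum (𝓞 ℚ)),
        continuousCohomology 1 (subgroupRep T'.toTopRep ((𝓛).level ⊥ r)) →+
          continuousCohomology 1 (subgroupRep
            (W.torsionGaloisModule ((p : ℤ) ^ k * (p : ℤ))).toTopRep ((𝓛).level ⊥ r)))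
      (comm : ∀ r : Finset (HeightOneSpectrum (𝓞 ℚ)),
        ((r : Finset _) : Set (HeightOneSpectrum (𝓞 ℚ))).Pairwise fun a b =>
          Commute (𝐃⟦ℤ, (W.torsionGaloisModule ((p : ℤ) ^ k * (p : ℤ))).toTopRep, ((𝓛).level ⊥ r), σ⟧ a)
            (𝐃⟦ℤ, (W.torsionGaloisModule ((p : ℤ) ^ k * (p : ℤ))).toTopRep, ((𝓛).level ⊥ r), σ⟧ b))
      (κ : Finset (HeightOneSpectrum (𝓞 ℚ)) →
        galoisCohomology (W.torsionGaloisModule ((p : ℤ) ^ k * (p : ℤ))) 1),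
      (∀ ℓ, σ ℓ ∈ (adicCompletionPrime ℚ ℓ).inertia (absoluteGaloisGroup ℚ)) ∧
      (∀ ℓ, modNCyclotomicCharacter ℚ (Ideal.absNorm ℓ.asIdeal) (σ ℓ) = η ℓ) ∧
      (∀ r, ∀ (φ : contOneCocycles (subgroupRep T'.toTopRep ((𝓛).level ⊥ r)))
        (ψ : contOneCocycles (subgroupRep
          (W.torsionGaloisModule ((p : ℤ) ^ k * (p : ℤ))).toTopRep ((𝓛).level ⊥ r))),
        (∀ g, ψ.1 g = e (φ.1 g)) → Φ r (oneCocycleClass _ φ) = oneCocycleClass _ ψ) ∧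
      D.IsKolyvaginSystem (propagatedSelmerStructure W p k) κ ∧
      (∀ r : Finset (HeightOneSpectrum (𝓞 ℚ)), ¬ (↑r : Set _) ⊆ D.primes → κ r = 0) ∧
      ∀ (r : Finset (HeightOneSpectrum (𝓞 ℚ))) (hr : (↑r : Set _) ⊆ D.primes),
        resSubgroup (W.torsionGaloisModule ((p : ℤ) ^ k * (p : ℤ))).toTopRep ((𝓛).level ⊥ r) 1 (κ r) =
          (r.noncommProd 𝐃⟦ℤ, (W.torsionGaloisModule ((p : ℤ) ^ k * (p : ℤ))).toTopRep,
              ((𝓛).level ⊥ r), σ⟧ (comm r))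
            (Φ r (𝐫⟦red, T', ((𝓛).level ⊥ r)⟧
              (c ⊥ ⟨r, fun _ hq => hPr (hr (Finset.mem_coe.2 hq))⟩))) := by
  have hm : (p : ℤ) ^ k * (p : ℤ) = ((p ^ (k + 1) : ℕ) : ℤ) := by push_cast; ring
  refine exists_isKolyvaginSystem_of_eulerSystem W p S hp2 hc red hred (Nat.succ_pos k) hM hm e hec he
    einv hic h₁ h₂ hirr D hT hD hPr hKol (propagatedSelmerStructure W p k) (fun w hw hne => ?_)
    fun w hw => ?_
  · -- good `w ≠ p`: `𝓕_can,w = H¹_ur`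
    exact (propagatedSelmerStructure_inr_eq_unramifiedSubgroup W p k
      (WeierstrassCurve.natCast_not_mem_asIdeal_of_primesEquiv_ne Fact.out hne) hw).ge
  · -- the bad places and `p`: the displayed certificates
    by_cases hwp : ((primesEquiv w : Nat.Primes) : ℕ) = p
    · exact htop w hwp
    · exact propagatedSelmerStructure_inr_eq_top_of_torsion_eq_zero W p k
        (WeierstrassCurve.natCast_not_mem_asIdeal_of_primesEquiv_ne Fact.out hwp)
        (hbad w (fun hgood => hw ⟨hgood, hwp⟩) hwp)

end Summit.BirchSwinnertonDyer.Rank1Residual.GaloisImage.Derivative.Rat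

end
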